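import Summits.ResolutionOfSingularities.ResolutionOfSingularities.Theorems.EquisingularLiftEquisingularLiftNatClusterLiftSurj
import Mathlib
import HarnessLib

/-!
# [OURS · L1 W4.5(b)] T-CLUSTER-LIFT part 7 — Δ-REGULARITY OFF AN EXCLUDED SET and the Δ-REGULAR CLUSTER-CENTRED CONE
# `Φ = G + c·ϖ·M` (`G`, `M` through the lifted cluster, `c` generic): centred at every section AND regular along `ϖ` at every
# special prime NOT over the excluded (= sectioned) points (crux `EquisingularLiftNat` = stmt-ResolutionOfSingularities-20038; v7′ TC⁺⁺)

NOT a statement of any manuscript. Helper file of the chain res-L1-w45b (cell `res-hironaka`, LADDER-RESOLUTION rung L, slot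
W4.5(b)); OURS; AI-written, weaker than expert review; `--supports stmt-ResolutionOfSingularities-20038 --as helper` by
res-L1-w45b-stub-3 (object T-CLUSTER-LIFT part 7 = offer (A)(i)+(ii-frame) of HOME STATUS 11:44Z). No `sorry`; standard axioms.

WHY. In res-L1-w45b-stub-1's HSUB′(ReachTC⁺) architecture (L/res-L1-w45b-stub-1/HSUB-TCPLUS3-skeleton.lean) a MEMBER cone is CENTRED
at ONE candidate point and Δ-regular at every OTHER special point; with ONE point in vertex position `[1:0:0]` no exclusion is
needed (the vertex chart is dropped: T-ΔLIFT-CENTRED p523916). A TC⁺⁺ member is centred at SEVERAL points at once, which cannot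
all be vertices of dropped charts, so the Δ-regularity clause must EXCLUDE the sectioned points explicitly. This file supplies:

* **`deltaRegularGeneric_mul_model_off`** — res-type-032's (Δ4, model form) `deltaRegularGeneric_mul_model` (…NatDeltaConeLift,
  p516044) WITH AN EXCLUDED SET `E` of primes of `k[x_σ]`: `O` a DVR, `ϖ` irreducible, `π : O ↠ k`, `ker π = (ϖ)`, `g h ∈ O[x_σ]`,
  finitely many bad primes `𝔮` of the trace (`π g ∈ 𝔮`, `π g ∈ 𝔪_𝔮²`), and `π h ∉ 𝔮` for the bad `𝔮` OUTSIDE `E` only ⇒ a finite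
  `S ⊂ k` such that for `π c ∉ S` the Δ-curve `O[x_σ]/(g + c·ϖ·h)` is a regular local ring at every prime `Q ∋ ϖ` whose
  downstairs prime is not in `E` (`∀ 𝔮 ∈ E, (π_*)⁻¹ 𝔮 ≠ Q ∩ O[x_σ]`). Same proof as 032's ((Δ2) pointwise + (Δ3) one bad residue),
  the exclusion threaded through;
* **`exists_isHomogeneous_clusterLift_deltaRegular_off`** — THE Δ-REGULAR CLUSTER-CENTRED CONE: `k` INFINITE; cluster data
  (charts `i_t`, sections `a_t`, orders `m_t`) with part 1's independence clause `hind` at the reduced cluster; `g ∈ k[T_σ]_d` of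
  order `≥ m_t` at each `ā_t`; per chart `j` an excluded set `E_j` and finitely many bad primes of `g(T_j := 1)`; a WITNESS form
  `M̄ ∈ k[T_σ]_d` of order `≥ m_t` at each `ā_t` with `M̄(T_j := 1) ∉ 𝔮` for every bad `𝔮 ∉ E_j` ⇒ a form `Φ ∈ O[T_σ]_d` with
  `π Φ = g`, `Φ(T_{i_t} := 1) ∈ 𝔪_{a_t}^{m_t}` for all `t` (CENTRED at every section) and, on every chart `j`, `O[T_{≠j}]/(Φ(T_j := 1))`
  regular at every prime `Q ∋ ϖ` not over `E_j`. Construction `Φ = G + c·ϖ·M`: `G` = part 1's lift of `g`, `M` = part 1's lift of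
  `M̄` (both through the cluster — the cluster conditions are `O`-linear, so `Φ` stays centred), `π c` off the union of the
  exclusion sets of `deltaRegularGeneric_mul_model_off` over the charts;
* `exists_isHomogeneous_clusterLift_deltaRegular_off_of_sum_le` — the same with `hind` discharged by part 5 (`Σ m_t ≤ d + 1`,
  pairwise distinct points of `ℙ`, `k` a field).
The witness `M̄` is left to the caller (typically: `E_j` = the cluster's primes on chart `j`, bad primes = the non-sectioned
singular points `b` of the trace, witness from part 5 applied to the cluster plus the simple point `b` when `Σ m_t ≤ d`); the
strict-transform charts over the sectioned points (package (vi)) are NOT treated here.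

References: res-type-032 …NatDeltaConeLift p516044 / …NatDeltaCriterionGeneric p513713 (proof pattern, cited lemmas); parts 1–6;
H. Matsumura, *Commutative Ring Theory* (1986), Thm. 14.2. res-L1-w45b-lead-2 LEAD-MEMO-5/6 (v7′), res-L1-w45b-stub-1 HSUB′ skeleton
(OURS planning texts, index only).
-/

set_option linter.dupNamespace false -- mandated namespace `Summit.<Summit>.<Problem>` of this single-conjunct summit
set_option linter.overlappingInstances false -- signatures carry both [IsDomain O] and [IsDiscreteValuationRing O]

noncomputable section

open MvPolynomial IsLocalRing Literature.AlgebraicGeometry.Resolution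
open Summit.ResolutionOfSingularities.ResolutionOfSingularities.Theorems
open Summit.ResolutionOfSingularities.ResolutionOfSingularities.Theorems.EquisingularLiftNat.ClusterLift

namespace Summit.ResolutionOfSingularities.ResolutionOfSingularities.Cruxes.EquisingularLiftNat.Sections

universe u

/-! ## (Δ4, model form) with an excluded set of primes -/

section GenericOff

variable {O : Type u} [CommRing O] [IsDomain O] [IsDiscreteValuationRing O] {ϖ : O}
variable {σ : Type u} [Finite σ]
variable {k : Type u} [Field k]

/-- **(Δ4) off an excluded set.** `O` a DVR with uniformizer `ϖ`, `π : O ↠ k` with `ker π = (ϖ)`, `g h ∈ O[x_σ]`, `E` a set of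
primes of `k[x_σ]` (the EXCLUDED points). Suppose the bad primes `𝔮` of the trace (`π g ∈ 𝔮`, `π g ∈ 𝔪_𝔮²`) are finitely many
and `π h ∉ 𝔮` for every bad `𝔮 ∉ E`. Then there is a finite `S ⊂ k` such that for every `c` with `π c ∉ S` the Δ-curve
`O[x_σ]/(g + c·ϖ·h)` is a regular local ring at every prime `Q ∋ ϖ` NOT lying over `E`. (res-type-032's
`deltaRegularGeneric_mul_model`, p516044, is the case `E = ∅`.) [cite: Matsumura1987, Thm. 14.2] [OURS · L1 W4.5b] -/
theorem deltaRegularGeneric_mul_model_off (hϖ : Irreducible ϖ) (π : O →+* k) (hπ : Function.Surjective π)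
    (hker : RingHom.ker π = Ideal.span {ϖ}) (g h : MvPolynomial σ O) (E : Set (PrimeSpectrum (MvPolynomial σ k)))
    (hfin : {𝔮 : PrimeSpectrum (MvPolynomial σ k) | MvPolynomial.map π g ∈ 𝔮.asIdeal ∧
      algebraMap (MvPolynomial σ k) (Localization.AtPrime 𝔮.asIdeal) (MvPolynomial.map π g) ∈
        maximalIdeal (Localization.AtPrime 𝔮.asIdeal) ^ 2}.Finite)
    (havoid : ∀ 𝔮 : PrimeSpectrum (MvPolynomial σ k), 𝔮 ∉ E → MvPolynomial.map π g ∈ 𝔮.asIdeal →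
      algebraMap (MvPolynomial σ k) (Localization.AtPrime 𝔮.asIdeal) (MvPolynomial.map π g) ∈
        maximalIdeal (Localization.AtPrime 𝔮.asIdeal) ^ 2 →
      MvPolynomial.map π h ∉ 𝔮.asIdeal) :
    ∃ S : Finset k, ∀ c : O, π c ∉ S →
      letI A := MvPolynomial σ O
      letI I : Ideal A := Ideal.span {g + C (c * ϖ) * h}
      ∀ (Q : Ideal (A ⧸ I)) [Q.IsPrime], Ideal.Quotient.mk I (C ϖ : A) ∈ Q →
        (∀ 𝔮 ∈ E, 𝔮.asIdeal.comap (MvPolynomial.map (σ := σ) π) ≠ Q.comap (Ideal.Quotient.mk I)) →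
        IsRegularLocalRing (Localization.AtPrime Q) := by
  classical
  -- adapted from res-type-032's `deltaRegularGeneric_mul_model` (…NatDeltaConeLift, p516044), exclusion threaded through
  have hkerC : RingHom.ker (MvPolynomial.map (σ := σ) π) = Ideal.span {(C ϖ : MvPolynomial σ O)} :=
    ker_map_eq_span_C_of_ker_eq π hker
  have hsurj : Function.Surjective (MvPolynomial.map (σ := σ) π) := MvPolynomial.map_surjective _ hπ
  have hπϖ : π ϖ = 0 := by
    rw [← RingHom.mem_ker, hker]
    exact Ideal.mem_span_singleton_self ϖ
  have hredϖ : MvPolynomial.map (σ := σ) π (C ϖ) = 0 := by rw [map_C, hπϖ, C_0]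
  have hEsub : ∀ 𝔮 : PrimeSpectrum (MvPolynomial σ k), MvPolynomial.map π h ∉ 𝔮.asIdeal →
      {r : k | ∃ c : O, π c = r ∧
        algebraMap (MvPolynomial σ O) (Localization.AtPrime (𝔮.asIdeal.comap (MvPolynomial.map (σ := σ) π)))
          (g + C (c * ϖ) * h) ∈ maximalIdeal _ ^ 2}.Subsingleton := by
    intro 𝔮 hh𝔮
    have hPϖ : (C ϖ : MvPolynomial σ O) ∈ 𝔮.asIdeal.comap (MvPolynomial.map (σ := σ) π) := by
      rw [Ideal.mem_comap, hredϖ]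
      exact Ideal.zero_mem _
    have hhP : h ∉ 𝔮.asIdeal.comap (MvPolynomial.map (σ := σ) π) := by rwa [Ideal.mem_comap]
    exact subsingleton_badResidue_model hϖ π hker g h _ hPϖ hhP
  -- the bad primes outside `E` (a subset of the finite set of bad primes)
  have hTfin : {𝔮 : PrimeSpectrum (MvPolynomial σ k) | (MvPolynomial.map π g ∈ 𝔮.asIdeal ∧
      algebraMap (MvPolynomial σ k) (Localization.AtPrime 𝔮.asIdeal) (MvPolynomial.map π g) ∈
        maximalIdeal (Localization.AtPrime 𝔮.asIdeal) ^ 2) ∧ 𝔮 ∉ E}.Finite :=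
    hfin.subset fun 𝔮 h𝔮 => h𝔮.1
  have hSfin := hTfin.biUnion fun 𝔮 h𝔮 => (hEsub 𝔮 (havoid 𝔮 h𝔮.2 h𝔮.1.1 h𝔮.1.2)).finite
  refine ⟨hSfin.toFinset, fun c hc => ?_⟩
  intro Q _ hQϖ hQE
  have hGP : g + C (c * ϖ) * h ∈ Q.comap (Ideal.Quotient.mk (Ideal.span {g + C (c * ϖ) * h})) := by
    rw [Ideal.mem_comap, Ideal.Quotient.eq_zero_iff_mem.mpr (Ideal.mem_span_singleton_self _)]
    exact Q.zero_mem
  have hϖP : (C ϖ : MvPolynomial σ O) ∈ Q.comap (Ideal.Quotient.mk (Ideal.span {g + C (c * ϖ) * h})) := by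
    rw [Ideal.mem_comap]; exact hQϖ
  have hgP : g ∈ Q.comap (Ideal.Quotient.mk (Ideal.span {g + C (c * ϖ) * h})) := by
    have h' := sub_mem hGP (Ideal.mul_mem_right h _ (Ideal.mul_mem_left _ (C c) hϖP))
    have e : g + C (c * ϖ) * h - C c * C ϖ * h = g := by rw [C_mul]; ring
    rwa [e] at h'
  have hkerP : RingHom.ker (MvPolynomial.map (σ := σ) π) ≤
      Q.comap (Ideal.Quotient.mk (Ideal.span {g + C (c * ϖ) * h})) := by
    rw [hkerC, Ideal.span_singleton_le_iff_mem]; exact hϖP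
  haveI h𝔮prime : ((Q.comap (Ideal.Quotient.mk (Ideal.span {g + C (c * ϖ) * h}))).map
      (MvPolynomial.map (σ := σ) π)).IsPrime :=
    Ideal.map_isPrime_of_surjective hsurj hkerP
  let 𝔮 : PrimeSpectrum (MvPolynomial σ k) :=
    ⟨(Q.comap (Ideal.Quotient.mk (Ideal.span {g + C (c * ϖ) * h}))).map (MvPolynomial.map π), h𝔮prime⟩
  have hcomapq : 𝔮.asIdeal.comap (MvPolynomial.map (σ := σ) π) =
      Q.comap (Ideal.Quotient.mk (Ideal.span {g + C (c * ϖ) * h})) := by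
    change ((Q.comap (Ideal.Quotient.mk (Ideal.span {g + C (c * ϖ) * h}))).map _).comap _ = _
    rw [Ideal.comap_map_of_surjective _ hsurj, ← RingHom.ker_eq_comap_bot, sup_eq_left.mpr hkerP]
  have hgq : MvPolynomial.map π g ∈ 𝔮.asIdeal := Ideal.mem_map_of_mem _ hgP
  have h𝔮E : 𝔮 ∉ E := fun hE => hQE 𝔮 hE hcomapq
  by_cases hcase : algebraMap (MvPolynomial σ k) (Localization.AtPrime 𝔮.asIdeal) (MvPolynomial.map π g) ∈
      maximalIdeal (Localization.AtPrime 𝔮.asIdeal) ^ 2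
  · -- bad prime outside `E`: `π h ∉ 𝔮`, at most one bad residue, which `π c` avoids
    haveI : IsRegularLocalRing (Localization.AtPrime
        (Q.comap (Ideal.Quotient.mk (Ideal.span {g + C (c * ϖ) * h})))) :=
      IsRegularRing.isRegularLocalRing_localization _
    refine isRegularLocalRing_localization_quotient_of_notMem_sq Q ?_
    intro hG2
    apply hc
    rw [Set.Finite.mem_toFinset, Set.mem_iUnion₂]
    refine ⟨𝔮, ⟨⟨hgq, hcase⟩, h𝔮E⟩, c, rfl, ?_⟩
    exact (mem_sq_maximalIdeal_localization_iff_of_eq hcomapq.symm _).mp hG2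
  · -- good prime: every lift is regular at `Q`
    refine isRegularLocalRing_localization_deltaCurve_of_notMem_sq_model_pt π Q 𝔮 hcomapq ?_
    rw [map_add_C_mul_mul_of_map_eq_zero π hπϖ]
    exact hcase

end GenericOff

/-! ## The Δ-regular cluster-centred cone -/

section ClusterCone

variable {O : Type u} [CommRing O] [IsDomain O] [IsDiscreteValuationRing O] {ϖ : O}
variable {σ : Type u} [Finite σ] [DecidableEq σ]
variable {k : Type u} [Field k]
variable {ι : Type*} [Finite ι]

/-- **THE Δ-REGULAR CLUSTER-CENTRED CONE (under the independence clause).** `O` a DVR, `ϖ` irreducible, `π : O ↠ k` onto an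
INFINITE field with `ker π = (ϖ)`. Cluster data: charts `i_t`, sections `a_t : {j ≠ i_t} → O`, orders `m_t`, with part 1's
INDEPENDENCE clause `hind` at the reduced cluster; `g ∈ k[T_σ]_d` of order `≥ m_t` at every `ā_t`. Regularity data: for every chart
`j` an excluded set `E_j` of primes of `k[T_{≠ j}]` and finiteness of the bad primes of `g(T_j := 1)`; a WITNESS `M̄ ∈ k[T_σ]_d` of
order `≥ m_t` at every `ā_t` with `M̄(T_j := 1) ∉ 𝔮` for every bad prime `𝔮 ∉ E_j` of every chart `j`. THEN there is a form
`Φ ∈ O[T_σ]_d` with `π Φ = g`, CENTRED: `Φ(T_{i_t} := 1) ∈ 𝔪_{a_t}^{m_t}` for all `t`, and Δ-REGULAR OFF `E`: for every chart `j`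
and every prime `Q ∋ ϖ` of `O[T_{≠ j}]/(Φ(T_j := 1))` not lying over `E_j`, the localisation is a regular local ring.
(`Φ = G + c·ϖ·M`; res-type-032's T-ΔLIFT p516044 is the clusterless case, res-L1-w45b-stub-1's T-ΔLIFT-CENTRED p523916 the one-vertex
case.) [cite: Matsumura1987, Thm. 14.2] [OURS · L1 W4.5b] -/
theorem exists_isHomogeneous_clusterLift_deltaRegular_off [Infinite k] (hϖ : Irreducible ϖ) (π : O →+* k)
    (hπ : Function.Surjective π) (hker : RingHom.ker π = Ideal.span {ϖ}) {d : ℕ}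
    (i : ι → σ) (a : (t : ι) → {j : σ // j ≠ i t} → O) (m : ι → ℕ)
    (hind : ∀ v : (t : ι) → ({j : σ // j ≠ i t} →₀ ℕ) → k, ∃ g' : MvPolynomial σ k, g'.IsHomogeneous d ∧
      ∀ t α, α.degree < m t →
        coeff α (aeval (fun j => (X j : MvPolynomial {j : σ // j ≠ i t} k) + C (π (a t j))) (dehomogenize (i t) g'))
          = v t α)
    (g : MvPolynomial σ k) (hg : g.IsHomogeneous d)
    (hgZ : ∀ t, dehomogenize (i t) g ∈
      (Ideal.span (Set.range fun j => (X j : MvPolynomial {j : σ // j ≠ i t} k) - C (π (a t j)))) ^ m t)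
    (E : (j : σ) → Set (PrimeSpectrum (MvPolynomial {l : σ // l ≠ j} k)))
    (hfin : ∀ j : σ, {𝔮 : PrimeSpectrum (MvPolynomial {l : σ // l ≠ j} k) |
      dehomogenize j g ∈ 𝔮.asIdeal ∧
      algebraMap (MvPolynomial {l : σ // l ≠ j} k) (Localization.AtPrime 𝔮.asIdeal) (dehomogenize j g) ∈
        maximalIdeal (Localization.AtPrime 𝔮.asIdeal) ^ 2}.Finite)
    (Mbar : MvPolynomial σ k) (hMbar : Mbar.IsHomogeneous d)
    (hMZ : ∀ t, dehomogenize (i t) Mbar ∈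
      (Ideal.span (Set.range fun j => (X j : MvPolynomial {j : σ // j ≠ i t} k) - C (π (a t j)))) ^ m t)
    (hMavoid : ∀ (j : σ) (𝔮 : PrimeSpectrum (MvPolynomial {l : σ // l ≠ j} k)), 𝔮 ∉ E j →
      dehomogenize j g ∈ 𝔮.asIdeal →
      algebraMap (MvPolynomial {l : σ // l ≠ j} k) (Localization.AtPrime 𝔮.asIdeal) (dehomogenize j g) ∈
        maximalIdeal (Localization.AtPrime 𝔮.asIdeal) ^ 2 →
      dehomogenize j Mbar ∉ 𝔮.asIdeal) :
    ∃ Φ : MvPolynomial σ O, Φ.IsHomogeneous d ∧ MvPolynomial.map π Φ = g ∧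
      (∀ t, dehomogenize (i t) Φ ∈
        (Ideal.span (Set.range fun j => (X j : MvPolynomial {j : σ // j ≠ i t} O) - C (a t j))) ^ m t) ∧
      ∀ (j : σ) (Q : Ideal (MvPolynomial {l : σ // l ≠ j} O ⧸ Ideal.span {dehomogenize j Φ})) [Q.IsPrime],
        Ideal.Quotient.mk (Ideal.span {dehomogenize j Φ}) (C ϖ : MvPolynomial {l : σ // l ≠ j} O) ∈ Q →
        (∀ 𝔮 ∈ E j, 𝔮.asIdeal.comap (MvPolynomial.map (σ := {l : σ // l ≠ j}) π) ≠
          Q.comap (Ideal.Quotient.mk (Ideal.span {dehomogenize j Φ}))) →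
        IsRegularLocalRing (Localization.AtPrime Q) := by
  classical
  haveI : Fintype σ := Fintype.ofFinite σ
  have hπϖ : π ϖ = 0 := by
    rw [← RingHom.mem_ker, hker]
    exact Ideal.mem_span_singleton_self ϖ
  -- the Jacobson hypothesis of part 1: `ker π = (ϖ) = 𝔪_O`
  have hkerj : RingHom.ker π ≤ (⊥ : Ideal O).jacobson := by
    rw [hker, ← hϖ.maximalIdeal_eq]
    exact IsLocalRing.maximalIdeal_le_jacobson _
  -- Step 1: the centred lifts `G` of `g` and `M` of `M̄` (part 1)
  obtain ⟨G, hG, hGg, hGZ⟩ := exists_isHomogeneous_lift_forall_dehomogenize_mem_pow π hπ hkerj i a m hind g hg hgZ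
  obtain ⟨M, hM, hMM, hMZ'⟩ := exists_isHomogeneous_lift_forall_dehomogenize_mem_pow π hπ hkerj i a m hind Mbar hMbar hMZ
  -- Step 2: on each chart, the finite exclusion set of `deltaRegularGeneric_mul_model_off`
  have hGj : ∀ j : σ, MvPolynomial.map π (dehomogenize j G) = dehomogenize j g := fun j => by
    rw [map_dehomogenize, hGg]
  have hMj : ∀ j : σ, MvPolynomial.map π (dehomogenize j M) = dehomogenize j Mbar := fun j => by
    rw [map_dehomogenize, hMM]
  have hchart := fun j : σ =>
    deltaRegularGeneric_mul_model_off hϖ π hπ hker (dehomogenize j G) (dehomogenize j M) (E j)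
      (by rw [hGj]; exact hfin j)
      (by
        intro 𝔮 h𝔮E h1 h2
        rw [hMj]
        rw [hGj] at h1 h2
        exact hMavoid j 𝔮 h𝔮E h1 h2)
  choose S hS using hchart
  -- Step 3: a value of `c` good for all charts
  obtain ⟨y, hy⟩ := Infinite.exists_notMem_finset (Finset.univ.biUnion S)
  obtain ⟨c, rfl⟩ := hπ y
  have hcS : ∀ j, π c ∉ S j := fun j hj => hy (Finset.mem_biUnion.mpr ⟨j, Finset.mem_univ _, hj⟩)
  refine ⟨G + C (c * ϖ) * M, hG.add (hM.C_mul _), ?_, fun t => ?_, fun j Q _ hQ hQE => ?_⟩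
  · rw [map_add_C_mul_mul_of_map_eq_zero π hπϖ, hGg]
  · -- centred: the cluster conditions are `O`-linear
    rw [map_add, map_mul, MvPolynomial.algHom_C, MvPolynomial.algebraMap_eq]
    exact Ideal.add_mem _ (hGZ t) (Ideal.mul_mem_left _ _ (hMZ' t))
  · have hdehom : dehomogenize j (G + C (c * ϖ) * M) = dehomogenize j G + C (c * ϖ) * dehomogenize j M := by
      rw [map_add, map_mul, MvPolynomial.aeval_C, MvPolynomial.algebraMap_eq]
    have key := hS j c (hcS j)
    revert Q
    rw [hdehom]
    intro Q _ hQ hQE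
    exact key Q hQ hQE

/-- **THE Δ-REGULAR CLUSTER-CENTRED CONE for `Σ m_t ≤ d + 1`** (independence discharged by part 5): as
`exists_isHomogeneous_clusterLift_deltaRegular_off`, with the cluster given by pairwise distinct points of `ℙ` (reductions of the
sections) and `Σ_t m_t ≤ d + 1` in place of `hind`. [cite: Matsumura1987, Thm. 14.2] [OURS · L1 W4.5b] -/
theorem exists_isHomogeneous_clusterLift_deltaRegular_off_of_sum_le [Infinite k] [Fintype ι] [DecidableEq ι]
    (hϖ : Irreducible ϖ) (π : O →+* k) (hπ : Function.Surjective π) (hker : RingHom.ker π = Ideal.span {ϖ}) {d : ℕ}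
    (i : ι → σ) (a : (t : ι) → {j : σ // j ≠ i t} → O)
    (hdist : ∀ t t', t ≠ t' → ¬ ∃ c : k, (fun l : σ => if h : l = i t' then (1 : k) else π (a t' ⟨l, h⟩)) =
      c • (fun l : σ => if h : l = i t then (1 : k) else π (a t ⟨l, h⟩)))
    (m : ι → ℕ) (hd : ∑ t, m t ≤ d + 1)
    (g : MvPolynomial σ k) (hg : g.IsHomogeneous d)
    (hgZ : ∀ t, dehomogenize (i t) g ∈
      (Ideal.span (Set.range fun j => (X j : MvPolynomial {j : σ // j ≠ i t} k) - C (π (a t j)))) ^ m t)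
    (E : (j : σ) → Set (PrimeSpectrum (MvPolynomial {l : σ // l ≠ j} k)))
    (hfin : ∀ j : σ, {𝔮 : PrimeSpectrum (MvPolynomial {l : σ // l ≠ j} k) |
      dehomogenize j g ∈ 𝔮.asIdeal ∧
      algebraMap (MvPolynomial {l : σ // l ≠ j} k) (Localization.AtPrime 𝔮.asIdeal) (dehomogenize j g) ∈
        maximalIdeal (Localization.AtPrime 𝔮.asIdeal) ^ 2}.Finite)
    (Mbar : MvPolynomial σ k) (hMbar : Mbar.IsHomogeneous d)
    (hMZ : ∀ t, dehomogenize (i t) Mbar ∈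
      (Ideal.span (Set.range fun j => (X j : MvPolynomial {j : σ // j ≠ i t} k) - C (π (a t j)))) ^ m t)
    (hMavoid : ∀ (j : σ) (𝔮 : PrimeSpectrum (MvPolynomial {l : σ // l ≠ j} k)), 𝔮 ∉ E j →
      dehomogenize j g ∈ 𝔮.asIdeal →
      algebraMap (MvPolynomial {l : σ // l ≠ j} k) (Localization.AtPrime 𝔮.asIdeal) (dehomogenize j g) ∈
        maximalIdeal (Localization.AtPrime 𝔮.asIdeal) ^ 2 →
      dehomogenize j Mbar ∉ 𝔮.asIdeal) :
    ∃ Φ : MvPolynomial σ O, Φ.IsHomogeneous d ∧ MvPolynomial.map π Φ = g ∧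
      (∀ t, dehomogenize (i t) Φ ∈
        (Ideal.span (Set.range fun j => (X j : MvPolynomial {j : σ // j ≠ i t} O) - C (a t j))) ^ m t) ∧
      ∀ (j : σ) (Q : Ideal (MvPolynomial {l : σ // l ≠ j} O ⧸ Ideal.span {dehomogenize j Φ})) [Q.IsPrime],
        Ideal.Quotient.mk (Ideal.span {dehomogenize j Φ}) (C ϖ : MvPolynomial {l : σ // l ≠ j} O) ∈ Q →
        (∀ 𝔮 ∈ E j, 𝔮.asIdeal.comap (MvPolynomial.map (σ := {l : σ // l ≠ j}) π) ≠
          Q.comap (Ideal.Quotient.mk (Ideal.span {dehomogenize j Φ}))) →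
        IsRegularLocalRing (Localization.AtPrime Q) :=
  exists_isHomogeneous_clusterLift_deltaRegular_off hϖ π hπ hker i a m
    (fun v => exists_isHomogeneous_forall_coeff_eq_charts i (fun t j => π (a t j)) hdist m hd v)
    g hg hgZ E hfin Mbar hMbar hMZ hMavoid

end ClusterCone

end Summit.ResolutionOfSingularities.ResolutionOfSingularities.Cruxes.EquisingularLiftNat.Sections

end
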